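import Literature.AlgebraicGeometry.Motives.HodgeThetaSubalgebraUnitaryRankOneRaise
import Literature.AlgebraicGeometry.Motives.HodgeThetaSubalgebraUnitaryPencil
import Literature.AlgebraicGeometry.Motives.HodgeThetaSubalgebraUnitaryCoprimeStep
import HarnessLib

/-!
# The `Θ`-subalgebra theorem for unitary multiplicities `(8, 9)` — the first STALL of the rank-raising ladder,
# closed classification-free by the double-Levi route (Ribet 1983 Thm. 3, Lie step; abelian 17-folds of type `(8, 9)`)

Family `hodge`, layer `Literature/AlgebraicGeometry/Motives` (pure linear algebra over `ℂ`; no geometry). Research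
context: cell `pub-hodge-ring2` (HONEST FRAMING: research route conditional on HC_CM; not a corollary; Q11.4-sentence-2
already refuted in dim ≥ 3), Literature lane gen 85, programme R70. UNCONDITIONAL; theorems only, no definition, no
named fact (D-0026), no `sorry`.

THE PRINT. K. A. Ribet, Amer. J. Math. 105 (1983), Thm. 3 = Gordon's survey Thm. 6.3 (3) [held
`paper:arxiv-alg-geom_9709030` p. 18]: `End⁰ = k` imaginary quadratic acting with coprime multiplicities `(n′, n″)` ⟹
`Hg = U(V, φ)`, `B•(Xⁿ) = D•(Xⁿ)`. Ribet's Lie step invokes the classification of minuscule representations (Serre); the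
lane replaces it pair by pair. After lit-g84 (programmes R64–R69) the rank-raising ladder covered `a ∈ {2,…,7, 11, 13}`
against every coprime `b`, and its closure was EXHAUSTED: at `(a, b) = (8, 9)` a raising operator of maximal rank `6` has
Levi types `(6 | 3)` and `(2 | 6)`, neither a core (lit-g84 README §HEIRS (α)).

THE NEW ROUTE (this programme). §1 **`UnitaryDoubleLevi.eq_top_of_raise_of_core`**: for `3 ≤ a < b`, ANY raising
operator of rank `ρ ≥ 1` whose larger-side Levi type `(ρ | b − ρ)` is a core forces `𝔊 = End(W)`
(`UnitaryLeviKernel.exists_rankOne_raise_of_core` + `UnitaryRankOneRaise.eq_top_of_rankOne_raise`). §2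
**`UnitaryEightNine.eq_top`**: at `(8, 9)` the ranks `1, 2, 4, 5, 7, 8` have cores `(1|8)`, `(2|7)`, `(4|5)`, `(5|4)`,
`(7|2)`, `(8|1)` in the tree, so if `𝔊 ≠ End(W)` every raising operator has rank in `{0, 3, 6}`; a raising operator of
rank `≥ 2` exists (`UnitaryThreeCoprime.exists_raise_rank_ge_two`); a rank-`3` one is impossible by the pencil lemma
(`UnitaryPencil.exists_pencil_of_core` with the `(5 | 3)` core: `1 + m₀ ∈ {0,3,6}` with `m₀ ≤ 3` gives `m₀ = 2`, while
`2 + m_c ∈ {0,3,6}` gives `m_c = 1` for `c = 1, −1, 2`, contradicting the three-point lemma); and a rank-`6` one yields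
(`UnitaryLeviKernel.exists_raise_commute_ne_zero`) a non-zero raising operator of rank `≤ 2 + 3 = 5`, i.e. of rank `3`.
**`UnitaryEightNine.eq_top'`** is the mirror `(9, 8)`. No `ℂ`-homogeneity of the Hermitian form is needed.

CONSEQUENCE (sequel `HodgeTheory/RibetTypeEightNinePowersHodgeClasses`): Ribet's theorem at `(n′, n″) = (8, 9)`;
the `p = 17` residual cell `{8, 9}` of the census is closed — every simple complex abelian 17-fold with `End⁰ ≠ ℚ`
satisfies `B• = D•` on all powers, unconditionally.

## References
* [Ribet1983] K. A. Ribet, *Hodge classes on certain types of abelian varieties*, Amer. J. Math. 105 (1983), Thm. 3.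
* [Gordon1997] B. B. Gordon, *A survey of the Hodge conjecture for abelian varieties*, Thm. 6.3 (3), pp. 18–19.
* [Deligne1982HodgeCycles] P. Deligne, *Hodge cycles on abelian varieties*, LNM 900 (1982), I §3 Prop. 3.4, 3.6.
* [GoodmanWallachGTM255] R. Goodman, N. R. Wallach, GTM 255 (2009), §4.1.1.
* [Humphreys1972] J. E. Humphreys, *Introduction to Lie Algebras and Representation Theory*, §19.1.
-/

noncomputable section

open Module

namespace Literature.AlgebraicGeometry.Motives

namespace HodgeStructure

universe u

variable {W : Type u} [AddCommGroup W] [Module ℂ W]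

/-! ### §1 Any raising operator with a larger-side core forces everything -/

/-- **Double Levi.** Setting of the unitary cores with `3 ≤ dim P < dim Q`; `B ∈ 𝔊` raising of rank `ρ ≥ 1`, and the
abstract core of type `(ρ | dim Q − ρ)` (hypothesis-schema `hcore`, as in `UnitaryRaisingRank.exists_raise_rank_gt`).
Then `𝔊 = End(W)`. (A rank-one raising operator exists by `UnitaryLeviKernel.exists_rankOne_raise_of_core`, and it
forces everything by `UnitaryRankOneRaise.eq_top_of_rankOne_raise`.) [cite: Ribet1983, Thm. 3]
[cite: Gordon1997, Thm. 6.3 (3)] [cite: Deligne1982HodgeCycles, I §3 Prop. 3.6] -/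
theorem UnitaryDoubleLevi.eq_top_of_raise_of_core [FiniteDimensional ℂ W] {𝔊 : Submodule ℂ (Module.End ℂ W)}
    (hbr : ∀ Y ∈ 𝔊, ∀ Z ∈ 𝔊, Y * Z - Z * Y ∈ 𝔊)
    (hirr : ∀ U : Submodule ℂ W, (∀ A ∈ 𝔊, ∀ u ∈ U, A u ∈ U) → U = ⊥ ∨ U = ⊤)
    {Θ : Module.End ℂ W} (hΘ : Θ ∈ 𝔊) (hΘΘ : Θ * Θ = 1)
    {P Q : Submodule ℂ W} (hP : ∀ x, x ∈ P ↔ Θ x = x) (hQ : ∀ x, x ∈ Q ↔ Θ x = -x)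
    {s : W → W → ℂ} (hadd : ∀ x y z, s (x + y) z = s x z + s y z) (hsymm : ∀ x y, s y x = starRingEnd ℂ (s x y))
    (hPQ : ∀ p ∈ P, ∀ q ∈ Q, s p q = 0) (hdefP : ∀ p ∈ P, s p p = 0 → p = 0) (hdefQ : ∀ q ∈ Q, s q q = 0 → q = 0)
    (hadj : ∀ X ∈ 𝔊, ∃ Y ∈ 𝔊, ∀ x y, s (X x) y = s x (Y y))
    {B : Module.End ℂ W} (hB : B ∈ 𝔊) (hΘB : Θ * B = B) (hBΘ : B * Θ = -B)
    (hr0 : 0 < Module.finrank ℂ (LinearMap.range B))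
    (hP3 : 3 ≤ Module.finrank ℂ P) (hab : Module.finrank ℂ P < Module.finrank ℂ Q)
    (hcore : ∀ (U : Submodule ℂ W) (𝔩 : Submodule ℂ (Module.End ℂ U)) (ι : Module.End ℂ U) (P' Q' : Submodule ℂ U),
      (∀ A ∈ 𝔩, ∀ A' ∈ 𝔩, A * A' - A' * A ∈ 𝔩) →
      (∀ V : Submodule ℂ U, (∀ A ∈ 𝔩, ∀ u ∈ V, A u ∈ V) → V = ⊥ ∨ V = ⊤) →
      ι ∈ 𝔩 → ι * ι = 1 → (∀ x, x ∈ P' ↔ ι x = x) → (∀ x, x ∈ Q' ↔ ι x = -x) →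
      Module.finrank ℂ P' = Module.finrank ℂ (LinearMap.range B) →
      Module.finrank ℂ Q' + Module.finrank ℂ (LinearMap.range B) = Module.finrank ℂ Q →
      (∀ p ∈ P', ∀ q ∈ Q', s (p : W) q = 0) → (∀ p ∈ P', s (p : W) p = 0 → p = 0) →
      (∀ q ∈ Q', s (q : W) q = 0 → q = 0) →
      (∀ A ∈ 𝔩, ∃ A' ∈ 𝔩, ∀ x y : U, s ((A x : U) : W) y = s x ((A' y : U) : W)) → 𝔩 = ⊤) : 𝔊 = ⊤ := by
  obtain ⟨B₁, hB₁, hΘB₁, hB₁Θ, hr1⟩ := UnitaryLeviKernel.exists_rankOne_raise_of_core hbr hirr hΘ hΘΘ hP hQ hadd hsymm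
    hPQ hdefP hdefQ hadj hB hΘB hBΘ hr0 hab (by omega) hcore
  exact UnitaryRankOneRaise.eq_top_of_rankOne_raise hbr hirr hΘ hΘΘ hP hQ hadd hsymm hPQ hdefP hdefQ hadj hB₁ hΘB₁ hB₁Θ
    hr1 (by omega) hP3 (by omega)

/-! ### §2 The `(8 | 9)` core -/

/-- **THE `Θ`-SUBALGEBRA THEOREM FOR UNITARY MULTIPLICITIES `(8, 9)` — complex Hermitian core, classification-free.**
`𝔊 ⊆ End(W)` bracket-closed and irreducible, `Θ ∈ 𝔊` an involution with `dim P = 8`, `dim Q = 9`, Hermitian data,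
`𝔊` adjoint-closed ⟹ `𝔊 = End(W)`. See the module docstring (double Levi at ranks `1, 2, 4, 5, 7, 8`; pencil at rank
`3`; the Levi centraliser of a rank-`6` operator). [cite: Ribet1983, Thm. 3] [cite: Gordon1997, Thm. 6.3 (3)]
[cite: Deligne1982HodgeCycles, I §3 Prop. 3.6] -/
theorem UnitaryEightNine.eq_top [FiniteDimensional ℂ W] {𝔊 : Submodule ℂ (Module.End ℂ W)}
    (hbr : ∀ Y ∈ 𝔊, ∀ Z ∈ 𝔊, Y * Z - Z * Y ∈ 𝔊)
    (hirr : ∀ U : Submodule ℂ W, (∀ A ∈ 𝔊, ∀ u ∈ U, A u ∈ U) → U = ⊥ ∨ U = ⊤)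
    {Θ : Module.End ℂ W} (hΘ : Θ ∈ 𝔊) (hΘΘ : Θ * Θ = 1)
    {P Q : Submodule ℂ W} (hP : ∀ x, x ∈ P ↔ Θ x = x) (hQ : ∀ x, x ∈ Q ↔ Θ x = -x)
    (hP8 : Module.finrank ℂ P = 8) (hQ9 : Module.finrank ℂ Q = 9)
    {s : W → W → ℂ} (hadd : ∀ x y z, s (x + y) z = s x z + s y z) (hsymm : ∀ x y, s y x = starRingEnd ℂ (s x y))
    (hPQ : ∀ p ∈ P, ∀ q ∈ Q, s p q = 0) (hdefP : ∀ p ∈ P, s p p = 0 → p = 0) (hdefQ : ∀ q ∈ Q, s q q = 0 → q = 0)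
    (hadj : ∀ X ∈ 𝔊, ∃ Y ∈ 𝔊, ∀ x y, s (X x) y = s x (Y y)) : 𝔊 = ⊤ := by
  classical
  have hraiseval : ∀ Z : Module.End ℂ W, Θ * Z = Z → ∀ w, Z w ∈ P := fun Z hΘZ w =>
    (hP _).2 (by rw [← Module.End.mul_apply, hΘZ])
  have hle8 : ∀ B' : Module.End ℂ W, Θ * B' = B' → Module.finrank ℂ (LinearMap.range B') ≤ 8 := fun B' h => by
    rw [← hP8]
    exact Submodule.finrank_mono (by rintro _ ⟨w, rfl⟩; exact hraiseval B' h w)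
  -- the Hermitian data restricted to a subspace
  have hsU : ∀ U : Submodule ℂ W, ∀ x y z : U, s ((x + y : U) : W) z = s (x : W) z + s (y : W) z :=
    fun U x y z => by simp only [Submodule.coe_add, hadd]
  -- STEP 1: the good ranks
  have key : ∀ B' ∈ 𝔊, Θ * B' = B' → B' * Θ = -B' →
      (Module.finrank ℂ (LinearMap.range B') = 1 ∨ Module.finrank ℂ (LinearMap.range B') = 2 ∨
        Module.finrank ℂ (LinearMap.range B') = 4 ∨ Module.finrank ℂ (LinearMap.range B') = 5 ∨
        Module.finrank ℂ (LinearMap.range B') = 7 ∨ Module.finrank ℂ (LinearMap.range B') = 8) → 𝔊 = ⊤ := by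
    intro B' hB' hΘB' hB'Θ hr
    refine UnitaryDoubleLevi.eq_top_of_raise_of_core hbr hirr hΘ hΘΘ hP hQ hadd hsymm hPQ hdefP hdefQ hadj hB' hΘB' hB'Θ
      (by omega) (by omega) (by omega)
      fun U 𝔩 ι P' Q' hbr𝔩 hirr𝔩 hι hιι hP' hQ' hfinP' hfinQ' hP'Q' hdefP' hdefQ' hadj𝔩 => ?_
    rw [hQ9] at hfinQ'
    rcases hr with h | h | h | h | h | h <;> rw [h] at hfinP' hfinQ'
    · -- `(1 | 8)`: the `(m, 1)` core for `−ι`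
      exact UnitaryThreeCoprime.eq_top_of_finrank_eq_one hbr𝔩 hirr𝔩 (Submodule.neg_mem _ hι)
        ((neg_mul_neg ι ι).trans hιι) (P := Q') (Q := P') (fun x => by rw [hQ', LinearMap.neg_apply, neg_eq_iff_eq_neg])
        (fun x => by rw [hP', LinearMap.neg_apply, neg_inj]) (by omega) hfinP'
    · -- `(2 | 7)`
      exact UnitaryTwoOdd.eq_top hbr𝔩 hirr𝔩 hι hιι hP' hQ' hfinP' ⟨3, by omega⟩ (s := fun x y : U => s (x : W) y)
        (hsU U) (fun x y => hsymm x y) hP'Q' hdefP' hdefQ' hadj𝔩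
    · -- `(4 | 5)`
      exact UnitaryCoprimeStep.eq_top_four_five hbr𝔩 hirr𝔩 hι hιι hP' hQ' hfinP' (by omega)
        (s := fun x y : U => s (x : W) y) (hsU U) (fun x y => hsymm x y) hP'Q' hdefP' hdefQ' hadj𝔩
    · -- `(5 | 4)`
      exact UnitaryCoprimeStep.eq_top_five_four hbr𝔩 hirr𝔩 hι hιι hP' hQ' hfinP' (by omega)
        (s := fun x y : U => s (x : W) y) (hsU U) (fun x y => hsymm x y) hP'Q' hdefP' hdefQ' hadj𝔩
    · -- `(7 | 2)`
      exact UnitaryTwoOdd.eq_top' hbr𝔩 hirr𝔩 hι hιι hP' hQ' (by rw [hfinP']; exact ⟨3, by norm_num⟩) (by omega)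
        (s := fun x y : U => s (x : W) y) (hsU U) (fun x y => hsymm x y) hP'Q' hdefP' hdefQ' hadj𝔩
    · -- `(8 | 1)`
      exact UnitaryThreeCoprime.eq_top_of_finrank_eq_one hbr𝔩 hirr𝔩 hι hιι hP' hQ' (by omega) (by omega)
  -- STEP 2: otherwise every raising operator has rank in `{0, 3, 6}`
  by_contra hne
  have hbad : ∀ B' ∈ 𝔊, Θ * B' = B' → B' * Θ = -B' →
      Module.finrank ℂ (LinearMap.range B') = 0 ∨ Module.finrank ℂ (LinearMap.range B') = 3 ∨
        Module.finrank ℂ (LinearMap.range B') = 6 := by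
    intro B' hB' hΘB' hB'Θ
    have h8 := hle8 B' hΘB'
    have hk : ¬ (Module.finrank ℂ (LinearMap.range B') = 1 ∨ Module.finrank ℂ (LinearMap.range B') = 2 ∨
        Module.finrank ℂ (LinearMap.range B') = 4 ∨ Module.finrank ℂ (LinearMap.range B') = 5 ∨
        Module.finrank ℂ (LinearMap.range B') = 7 ∨ Module.finrank ℂ (LinearMap.range B') = 8) :=
      fun h => hne (key B' hB' hΘB' hB'Θ h)
    omega
  obtain ⟨B₂, hB₂, hΘB₂, hB₂Θ, hr2⟩ :=
    UnitaryThreeCoprime.exists_raise_rank_ge_two hbr hirr hΘ hΘΘ hP hQ (by omega) (by omega)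
  by_cases h3 : ∃ A ∈ 𝔊, Θ * A = A ∧ A * Θ = -A ∧ Module.finrank ℂ (LinearMap.range A) = 3
  · -- STEP 3: a rank-three raising operator is impossible (pencil through the `(5 | 3)` core)
    obtain ⟨A, hA, hΘA, hAΘ, hA3⟩ := h3
    obtain ⟨B₁, hB₁, B₂', hB₂', hΘB₁, hB₁Θ, hΘB₂', hB₂'Θ, m₀, m₁, m₂, m₃, hm₀, hm₁, hm₂, hm₃, hr₀, hr₁, hr₂, hr₃, himp⟩ :=
      UnitaryPencil.exists_pencil_of_core hbr hirr hΘ hΘΘ hP hQ hadd hsymm hPQ hdefP hdefQ hadj hA hΘA hAΘ (by omega)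
        (by omega)
        fun U 𝔩 ι P' Q' hbr𝔩 hirr𝔩 hι hιι hP' hQ' hfinP' hfinQ' hP'Q' hdefP' hdefQ' hadj𝔩 => by
          rw [hA3, hP8] at hfinP'
          rw [hA3] at hfinQ'
          exact UnitaryThreeCoprime.eq_top' hbr𝔩 hirr𝔩 hι hιι hP' hQ' (by omega) hfinQ'
            (s := fun x y : U => s (x : W) y) (hsU U) (fun x y => hsymm x y) hP'Q' hdefP' hdefQ' hadj𝔩
    rw [hA3] at hm₀ hm₁ hm₂ hm₃
    have e₀ := hbad B₁ hB₁ hΘB₁ hB₁Θ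
    have e₁ := hbad (B₁ + B₂') (Submodule.add_mem _ hB₁ hB₂') (by rw [mul_add, hΘB₁, hΘB₂'])
      (by rw [add_mul, hB₁Θ, hB₂'Θ, neg_add])
    have e₂ := hbad (B₁ - B₂') (Submodule.sub_mem _ hB₁ hB₂') (by rw [mul_sub, hΘB₁, hΘB₂'])
      (by rw [sub_mul, hB₁Θ, hB₂'Θ, neg_sub_neg, neg_sub])
    have e₃ := hbad (B₁ + (2 : ℂ) • B₂') (Submodule.add_mem _ hB₁ (Submodule.smul_mem _ _ hB₂'))
      (by rw [mul_add, mul_smul_comm, hΘB₁, hΘB₂']) (by rw [add_mul, smul_mul_assoc, hB₁Θ, hB₂'Θ, smul_neg, neg_add])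
    rw [hr₀] at e₀; rw [hr₁] at e₁; rw [hr₂] at e₂; rw [hr₃] at e₃
    have := himp (by omega) (by omega) (by omega)
    omega
  · -- STEP 4: all non-zero raising operators have rank `6`; the Levi centraliser of one of them has rank `≤ 5`
    have h6 : Module.finrank ℂ (LinearMap.range B₂) = 6 := by
      rcases hbad B₂ hB₂ hΘB₂ hB₂Θ with h | h | h
      · omega
      · exact absurd ⟨B₂, hB₂, hΘB₂, hB₂Θ, h⟩ h3
      · exact h
    obtain ⟨B', hB', hΘB', hB'Θ, hB'ne, hrk⟩ := UnitaryLeviKernel.exists_raise_commute_ne_zero hbr hirr hΘ hΘΘ hP hQ hadd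
      hsymm hPQ hdefP hdefQ hadj hB₂ hΘB₂ hB₂Θ (by omega) (by omega)
    rw [h6, hP8, hQ9] at hrk
    have hpos : 0 < Module.finrank ℂ (LinearMap.range B') := by
      rw [Module.finrank_pos_iff_exists_ne_zero]
      by_contra h0
      push Not at h0
      apply hB'ne
      refine LinearMap.ext fun w => ?_
      have := h0 ⟨B' w, LinearMap.mem_range_self B' w⟩
      rw [LinearMap.zero_apply]
      exact congrArg Subtype.val this
    rcases hbad B' hB' hΘB' hB'Θ with h | h | h
    · omega
    · exact h3 ⟨B', hB', hΘB', hB'Θ, h⟩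
    · omega

/-- **The mirror core `(9, 8)`** (apply `eq_top` to `−Θ`). [cite: Ribet1983, Thm. 3] [cite: Gordon1997, Thm. 6.3 (3)] -/
theorem UnitaryEightNine.eq_top' [FiniteDimensional ℂ W] {𝔊 : Submodule ℂ (Module.End ℂ W)}
    (hbr : ∀ Y ∈ 𝔊, ∀ Z ∈ 𝔊, Y * Z - Z * Y ∈ 𝔊)
    (hirr : ∀ U : Submodule ℂ W, (∀ A ∈ 𝔊, ∀ u ∈ U, A u ∈ U) → U = ⊥ ∨ U = ⊤)
    {Θ : Module.End ℂ W} (hΘ : Θ ∈ 𝔊) (hΘΘ : Θ * Θ = 1)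
    {P Q : Submodule ℂ W} (hP : ∀ x, x ∈ P ↔ Θ x = x) (hQ : ∀ x, x ∈ Q ↔ Θ x = -x)
    (hP9 : Module.finrank ℂ P = 9) (hQ8 : Module.finrank ℂ Q = 8)
    {s : W → W → ℂ} (hadd : ∀ x y z, s (x + y) z = s x z + s y z) (hsymm : ∀ x y, s y x = starRingEnd ℂ (s x y))
    (hPQ : ∀ p ∈ P, ∀ q ∈ Q, s p q = 0) (hdefP : ∀ p ∈ P, s p p = 0 → p = 0) (hdefQ : ∀ q ∈ Q, s q q = 0 → q = 0)
    (hadj : ∀ X ∈ 𝔊, ∃ Y ∈ 𝔊, ∀ x y, s (X x) y = s x (Y y)) : 𝔊 = ⊤ := by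
  have hnΘ : -Θ ∈ 𝔊 := Submodule.neg_mem _ hΘ
  have hnΘΘ : (-Θ) * (-Θ) = 1 := by rw [neg_mul_neg, hΘΘ]
  exact UnitaryEightNine.eq_top hbr hirr hnΘ hnΘΘ (P := Q) (Q := P)
    (fun x => by rw [hQ, LinearMap.neg_apply, neg_eq_iff_eq_neg]) (fun x => by rw [hP, LinearMap.neg_apply, neg_inj])
    hQ8 hP9 hadd hsymm (fun p hp q hq => by rw [hsymm, hPQ q hq p hp, map_zero]) hdefQ hdefP hadj

end HodgeStructure

end Literature.AlgebraicGeometry.Motives
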